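import Mathlib
import Summits.Ventures.HodgeRepro.Tier4.Common.AdelicDefs
import Summits.Ventures.HodgeRepro.Tier4.Common.AdelicPlaces
import Summits.Ventures.HodgeRepro.Tier4.Common.LocalTorus
import Summits.Ventures.HodgeRepro.Tier4.Common.LocalTorusCompact
import Summits.Ventures.HodgeRepro.Tier4.Common.CompactOpenLevel
import Summits.Ventures.HodgeRepro.Tier4.Line1.AdelicParts
import Summits.Ventures.HodgeRepro.Tier4.Line1.FiniteLevelIsolation

/-!
# Tier4/Line4/PlaceIdem — the idempotent `1_v` of the finite adeles and the `v`-part / away-from-`v` part of a finite-adele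
matrix (C-L4-PSPLIT, Part A.1a)

Blind re-derivation cell `pub-hodge-repro`, Tier 4 «prove the step» (README §9–§10), seat t4-L2-p1 (gen 3; plan-4 g5's cut
C-L4-PSPLIT S15510, statement S15526).  Tree path `lean/Summits/Ventures/HodgeRepro/Tier4/Line4/PlaceIdem.lean` (the `G(𝔸)`-level parts are the companion
`Line4/PlacePart.lean`, the 400-line rule).  Definitions
lane.  Mathlib-level; no literature.

THE IDEMPOTENT.  `placeIdem k v ∈ 𝔸_{k,f}` is the finite adele `1_v` with component `1` at `v` and `0` elsewhere
(`placeIdem_apply`, `placeIdem_mul_self`).  For a finite-adele matrix `F`, `atFinM k v F := 1_v • F + (1 − 1_v) • 1` is `F` at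
`v` and the identity matrix at every other finite place; `awayFinM k v F := (1 − 1_v) • F + 1_v • 1` is the identity at `v` and
`F` elsewhere (`atFinM_apply_apply`, `awayFinM_apply_apply`).  Both are multiplicative, unital, transpose-compatible, and
`atFinM v F * awayFinM v F = F` — all from `e² = e` (`idemMix_*`, proved once for an idempotent `e`).
Nothing here says anything about the status of the Hodge conjecture for CM abelian varieties, which is NOT proved
(HC_CM is NOT proved by anyone in this repository).
-/

set_option autoImplicit false
noncomputable section
namespace Summit.Ventures.HodgeRepro.Tier4.Line4
open Summit.Ventures.HodgeRepro.Tier4 Summit.Ventures.HodgeRepro.Tier4.Common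
  Summit.Ventures.HodgeRepro.Tier4.Line1 NumberField IsDedekindDomain Matrix
open scoped NumberField Classical

section Idem
variable {k : Type} [Field k] [NumberField k]

/-- Components of a sum of finite adeles. -/
theorem fa_add_apply (x y : FiniteAdeleRing (𝓞 k) k) (w : HeightOneSpectrum (𝓞 k)) : (x + y) w = x w + y w := rfl
/-- Components of a product of finite adeles. -/
theorem fa_mul_apply (x y : FiniteAdeleRing (𝓞 k) k) (w : HeightOneSpectrum (𝓞 k)) : (x * y) w = x w * y w := rfl
/-- Components of a difference of finite adeles. -/
theorem fa_sub_apply (x y : FiniteAdeleRing (𝓞 k) k) (w : HeightOneSpectrum (𝓞 k)) : (x - y) w = x w - y w := rfl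
/-- Components of `1`. -/
theorem fa_one_apply (w : HeightOneSpectrum (𝓞 k)) : (1 : FiniteAdeleRing (𝓞 k) k) w = 1 := rfl
/-- Components of `0`. -/
theorem fa_zero_apply (w : HeightOneSpectrum (𝓞 k)) : (0 : FiniteAdeleRing (𝓞 k) k) w = 0 := rfl
/-- A finite adele is determined by its components. -/
theorem fa_ext {x y : FiniteAdeleRing (𝓞 k) k} (h : ∀ w, x w = y w) : x = y := RestrictedProduct.ext _ _ h

variable (k)

/-- **The idempotent `1_v`**: the finite adele with component `1` at `v` and `0` at every other finite place. -/
def placeIdem (v : HeightOneSpectrum (𝓞 k)) : FiniteAdeleRing (𝓞 k) k :=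
  RestrictedProduct.mk (fun w : HeightOneSpectrum (𝓞 k) => if w = v then (1 : w.adicCompletion k) else 0)
    (Filter.Eventually.of_forall fun w => by
      split_ifs
      · exact one_mem _
      · exact zero_mem _)

/-- The components of `1_v`. -/
theorem placeIdem_apply (v w : HeightOneSpectrum (𝓞 k)) :
    placeIdem k v w = if w = v then (1 : w.adicCompletion k) else 0 := rfl

/-- `1_v` is idempotent. -/
theorem placeIdem_mul_self (v : HeightOneSpectrum (𝓞 k)) : placeIdem k v * placeIdem k v = placeIdem k v := by
  refine fa_ext fun w => ?_
  rw [fa_mul_apply, placeIdem_apply]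
  split_ifs <;> simp

/-- The complementary idempotent `1 − 1_v` is idempotent. -/
theorem one_sub_placeIdem_mul_self (v : HeightOneSpectrum (𝓞 k)) :
    (1 - placeIdem k v) * (1 - placeIdem k v) = 1 - placeIdem k v := by
  rw [sub_mul, one_mul, mul_sub, mul_one, placeIdem_mul_self, sub_self, sub_zero]

/-- The components of `1 − 1_v`. -/
theorem one_sub_placeIdem_apply (v w : HeightOneSpectrum (𝓞 k)) :
    (1 - placeIdem k v) w = if w = v then (0 : w.adicCompletion k) else 1 := by
  rw [fa_sub_apply, fa_one_apply, placeIdem_apply]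
  split_ifs <;> simp

/-- `M₄` over the finite adeles. -/
abbrev M4f : Type := Matrix (Fin 4) (Fin 4) (FiniteAdeleRing (𝓞 k) k)

/-- The `e`-mix of a matrix: `e • F + (1 − e) • 1`, for an idempotent `e`. -/
def idemMix (e : FiniteAdeleRing (𝓞 k) k) (F : M4f k) : M4f k := e • F + (1 - e) • (1 : M4f k)

variable {k}

/-- `idemMix e 1 = 1`. -/
theorem idemMix_one (e : FiniteAdeleRing (𝓞 k) k) : idemMix k e 1 = 1 := by
  unfold idemMix
  rw [← add_smul, add_sub_cancel, one_smul]

/-- Transpose commutes with the `e`-mix. -/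
theorem idemMix_transpose (e : FiniteAdeleRing (𝓞 k) k) (F : M4f k) : (idemMix k e F)ᵀ = idemMix k e Fᵀ := by
  unfold idemMix
  rw [Matrix.transpose_add, Matrix.transpose_smul, Matrix.transpose_smul, Matrix.transpose_one]

/-- The `e`-mix is multiplicative (`e` idempotent). -/
theorem idemMix_mul {e : FiniteAdeleRing (𝓞 k) k} (he : e * e = e) (F G : M4f k) :
    idemMix k e (F * G) = idemMix k e F * idemMix k e G := by
  have h1 : e * (1 - e) = 0 := by rw [mul_sub, mul_one, he, sub_self]
  have h2 : (1 - e) * e = 0 := by rw [sub_mul, one_mul, he, sub_self]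
  have h3 : (1 - e) * (1 - e) = 1 - e := by rw [sub_mul, one_mul, mul_sub, mul_one, he, sub_self, sub_zero]
  unfold idemMix
  simp only [Matrix.add_mul, Matrix.mul_add, Matrix.smul_mul, Matrix.mul_smul, Matrix.mul_one, Matrix.one_mul,
    smul_add, smul_smul, he, h1, h2, h3, zero_smul, add_zero, zero_add]

/-- `idemMix e F * idemMix (1 − e) F = F`. -/
theorem idemMix_mul_idemMix_one_sub {e : FiniteAdeleRing (𝓞 k) k} (he : e * e = e) (F : M4f k) :
    idemMix k e F * idemMix k (1 - e) F = F := by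
  have h1 : e * (1 - e) = 0 := by rw [mul_sub, mul_one, he, sub_self]
  have h2 : (1 - e) * e = 0 := by rw [sub_mul, one_mul, he, sub_self]
  have h3 : (1 - e) * (1 - e) = 1 - e := by rw [sub_mul, one_mul, mul_sub, mul_one, he, sub_self, sub_zero]
  unfold idemMix
  rw [sub_sub_cancel]
  simp only [Matrix.add_mul, Matrix.mul_add, Matrix.smul_mul, Matrix.mul_smul, Matrix.mul_one, Matrix.one_mul,
    smul_add, smul_smul, he, h1, h2, h3, zero_smul, add_zero, zero_add]
  first
  | rw [sub_add_cancel, one_smul]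
  | rw [← add_smul, sub_add_cancel, one_smul]

/-- If `F` commutes with `C`, so does `idemMix e F`. -/
theorem idemMix_mul_comm_of_comm (e : FiniteAdeleRing (𝓞 k) k) {F C : M4f k} (h : F * C = C * F) :
    idemMix k e F * C = C * idemMix k e F := by
  unfold idemMix
  rw [Matrix.add_mul, Matrix.mul_add, Matrix.smul_mul, Matrix.mul_smul, Matrix.smul_mul, Matrix.mul_smul,
    Matrix.one_mul, Matrix.mul_one, h]

/-- If `F B Fᵀ = B`, then `idemMix e F · B · (idemMix e F)ᵀ = B` (`e` idempotent). -/
theorem idemMix_mul_mul_transpose_of {e : FiniteAdeleRing (𝓞 k) k} (he : e * e = e) {F B : M4f k}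
    (h : F * B * Fᵀ = B) : idemMix k e F * B * (idemMix k e F)ᵀ = B := by
  have h1 : e * (1 - e) = 0 := by rw [mul_sub, mul_one, he, sub_self]
  have h2 : (1 - e) * e = 0 := by rw [sub_mul, one_mul, he, sub_self]
  have h3 : (1 - e) * (1 - e) = 1 - e := by rw [sub_mul, one_mul, mul_sub, mul_one, he, sub_self, sub_zero]
  rw [idemMix_transpose]
  unfold idemMix
  simp only [Matrix.add_mul, Matrix.mul_add, Matrix.smul_mul, Matrix.mul_smul, Matrix.mul_one, Matrix.one_mul,
    smul_add, smul_smul, he, h1, h2, h3, zero_smul, add_zero, zero_add, h]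
  rw [← add_smul, add_sub_cancel, one_smul]

variable (k)

/-- **The `v`-part of a finite-adele matrix**: `F` at `v`, the identity elsewhere. -/
def atFinM (v : HeightOneSpectrum (𝓞 k)) (F : M4f k) : M4f k := idemMix k (placeIdem k v) F

/-- **The away-from-`v` part of a finite-adele matrix**: the identity at `v`, `F` elsewhere. -/
def awayFinM (v : HeightOneSpectrum (𝓞 k)) (F : M4f k) : M4f k := idemMix k (1 - placeIdem k v) F

variable {k}
variable (v : HeightOneSpectrum (𝓞 k))

/-- The `v`-part of `1` is `1`. -/
theorem atFinM_one : atFinM k v 1 = 1 := idemMix_one _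
/-- The away part of `1` is `1`. -/
theorem awayFinM_one : awayFinM k v 1 = 1 := idemMix_one _
/-- The `v`-part is multiplicative. -/
theorem atFinM_mul (F G : M4f k) : atFinM k v (F * G) = atFinM k v F * atFinM k v G :=
  idemMix_mul (placeIdem_mul_self k v) F G
/-- The away part is multiplicative. -/
theorem awayFinM_mul (F G : M4f k) : awayFinM k v (F * G) = awayFinM k v F * awayFinM k v G :=
  idemMix_mul (one_sub_placeIdem_mul_self k v) F G
/-- The `v`-part commutes with transpose. -/
theorem atFinM_transpose (F : M4f k) : (atFinM k v F)ᵀ = atFinM k v Fᵀ := idemMix_transpose _ F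
/-- The away part commutes with transpose. -/
theorem awayFinM_transpose (F : M4f k) : (awayFinM k v F)ᵀ = awayFinM k v Fᵀ := idemMix_transpose _ F

/-- `F = F_v · F^{(v)}`. -/
theorem atFinM_mul_awayFinM (F : M4f k) : atFinM k v F * awayFinM k v F = F :=
  idemMix_mul_idemMix_one_sub (placeIdem_mul_self k v) F

/-- The components of the `v`-part: `F` at `v`, the identity elsewhere. -/
theorem atFinM_apply_apply (F : M4f k) (i j : Fin 4) (w : HeightOneSpectrum (𝓞 k)) :
    atFinM k v F i j w = if w = v then F i j w else (1 : M4f k) i j w := by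
  show (placeIdem k v * F i j + (1 - placeIdem k v) * (1 : M4f k) i j) w = _
  rw [fa_add_apply, fa_mul_apply, fa_mul_apply, placeIdem_apply, one_sub_placeIdem_apply]
  split_ifs <;> simp

/-- The components of the away part: the identity at `v`, `F` elsewhere. -/
theorem awayFinM_apply_apply (F : M4f k) (i j : Fin 4) (w : HeightOneSpectrum (𝓞 k)) :
    awayFinM k v F i j w = if w = v then (1 : M4f k) i j w else F i j w := by
  show ((1 - placeIdem k v) * F i j + (1 - (1 - placeIdem k v)) * (1 : M4f k) i j) w = _
  rw [sub_sub_cancel, fa_add_apply, fa_mul_apply, fa_mul_apply, placeIdem_apply, one_sub_placeIdem_apply]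
  split_ifs <;> simp

/-- A matrix that is the identity away from `v` is its own `v`-part. -/
theorem atFinM_eq_self_of_forall_ne {F : M4f k} (h : ∀ w, w ≠ v → ∀ i j, F i j w = (1 : M4f k) i j w) :
    atFinM k v F = F := by
  refine Matrix.ext fun i j => fa_ext fun w => ?_
  rw [atFinM_apply_apply]
  split_ifs with hw
  · rfl
  · exact (h w hw i j).symm

/-- A matrix that is the identity at `v` has `v`-part `1`. -/
theorem atFinM_eq_one_of_forall {F : M4f k} (h : ∀ i j, F i j v = (1 : M4f k) i j v) : atFinM k v F = 1 := by
  refine Matrix.ext fun i j => fa_ext fun w => ?_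
  rw [atFinM_apply_apply]
  split_ifs with hw
  · rw [hw]; exact h i j
  · rfl

/-- A matrix that is the identity away from `v` has away part `1`. -/
theorem awayFinM_eq_one_of_forall_ne {F : M4f k} (h : ∀ w, w ≠ v → ∀ i j, F i j w = (1 : M4f k) i j w) :
    awayFinM k v F = 1 := by
  refine Matrix.ext fun i j => fa_ext fun w => ?_
  rw [awayFinM_apply_apply]
  split_ifs with hw
  · rfl
  · exact h w hw i j

/-- A matrix that is the identity at `v` is its own away part. -/
theorem awayFinM_eq_self_of_forall {F : M4f k} (h : ∀ i j, F i j v = (1 : M4f k) i j v) : awayFinM k v F = F := by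
  refine Matrix.ext fun i j => fa_ext fun w => ?_
  rw [awayFinM_apply_apply]
  split_ifs with hw
  · rw [hw]; exact (h i j).symm
  · rfl

end Idem

end Summit.Ventures.HodgeRepro.Tier4.Line4

end
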